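import Mathlib.MeasureTheory.Function.Jacobian
import Mathlib.MeasureTheory.Constructions.HaarToSphere
import Mathlib.MeasureTheory.Measure.Haar.InnerProductSpace
import Mathlib.Analysis.InnerProductSpace.Calculus
import Mathlib.Analysis.Calculus.Deriv.Inv
import Mathlib.Tactic.Module
import Literature.Analysis.FluidPDE.CollisionCylinder
import Literature.Analysis.Potential.HyperbolicPoissonKernel
import HarnessLib

/-!
# Discharged fact: the Möbius change of variables on the sphere (Stoll 2016, (5.3.1))

`Literature.Analysis.Potential.HyperbolicPoissonKernel` states, as the named fact
`Literature.Analysis.Potential.Stoll2016_eq531`, equation (5.3.1) of M. Stoll, *Harmonic and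
Subharmonic Function Theory on the Hyperbolic Ball*, LMS Lecture Note Ser. 431 (2016), p. 59:
"`∫_𝕊 f(φ_a(t)) dσ(t) = ∫_𝕊 P_h(a,t) f(t) dσ(t)` for all `f ∈ L¹(𝕊)`", `a ∈ 𝔹 ⊂ ℝⁿ`, `n ≥ 2`,
`φ_a` the Möbius involution (2.1.6) and `P_h(a,t) = ((1 − |a|²)/|t − a|²)^{n−1}` the invariant
Poisson kernel (5.1.5). This file PROVES it (`Stoll2016_eq531_holds`).

## Proof

Stoll prints (5.3.1) as the case `ψ = φ_a`, `x = 0` of Theorem 5.3.5 (`P_h[f ∘ ψ] = P_h[f] ∘ ψ`),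
itself obtained from the solution of the Dirichlet problem (Theorem 5.3.3, Corollary 5.3.4) and the
maximum principle. We take the genuinely shorter road in Lean and prove (5.3.1) for what it is —
the change-of-variables formula for `φ_a|_𝕊`, whose Jacobian with respect to `σ` is `P_h(a,·)` —
from Mathlib's change of variables `integral_image_eq_integral_abs_det_fderiv_smul` and polar
coordinates `Measure.measurePreserving_homeomorphUnitSphereProd`:

1. On `𝕊`, by (2.1.1)–(2.1.4) (`φ_a = ψ_a^*`, `|ψ_a| = 1` on `𝕊`),
   `φ_a(t) = J(t) := a − κ (t − a)/|t − a|²`, `κ = 1 − |a|²` (`SphereMoebius.sphInv`,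
   `SphereMoebius.moebius_eq_sphInv`); `J` maps `𝕊` to `𝕊`, is an involution there, and
   `P_h(a,J t) P_h(a,t) = 1` (Exercise 2.4.3 of the book).
2. The radial extension `Ψ(x) = |x| J(x/|x|)` (`SphereMoebius.radExt`) is a norm-preserving
   involution of `V ∖ {0}`; at a unit vector `t` its derivative factors as `R ∘ D'` with
   `R = 1 − (2/|t−a|²)(t−a) ⊗ (t−a)` (a reflection, `det R = −1`) and
   `D' = −c·1 + (1+c) t ⊗ t`, `c = κ/|t−a|²` (`det D' = (−c)^{n−1}` by the rank-one determinant
   lemma `Literature.Analysis.FluidPDE.LinearMap.det_smul_one_add_smulRight`), so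
   `|det DΨ(t)| = c^{n−1} = P_h(a,t)`; by homogeneity `DΨ(x) = DΨ(x/|x|)`.
3. Change of variables for `Ψ` on `V ∖ {0}` and the kernel identity give
   `∫_𝔹 (P_h(a,·) f)(x/|x|) dx = ∫_𝔹 (f ∘ J)(x/|x|) dx`, and polar coordinates
   (`SphereMoebius.integral_ball_comp_normalize`: `∫_𝔹 G(x/|x|) dμ = (dim V)⁻¹ ∫ G dμ.toSphere`,
   hypothesis-free for the Bochner integral) turn both sides into the two sides of (5.3.1).

The integrability hypothesis of the named fact is not used (both sides are Bochner integrals with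
the same junk value). Generic lemmas reused from `Literature.Analysis.FluidPDE.CollisionCylinder`:
the rank-one determinant lemmas and the derivative of the norm.

Layout: the light sibling `Literature.Analysis.Potential.HyperbolicPoissonKernelProofs` holds the
purely algebraic discharges of that fact file ((2.1.7), Exercise 2.4.3) with no extra imports; this
discharge needs Mathlib's Jacobian change of variables and polar coordinates, so it lives in its
own sibling file to keep those imports away from the algebraic one. Not importable together with
this file: `Literature.Analysis.Potential.HyperbolicBallPoisson` (it re-declares
`HyperbolicBall.rho/moebius/poissonKernel` under the same fully-qualified names).

## References

* M. Stoll, *Harmonic and Subharmonic Function Theory on the Hyperbolic Ball*, LMS Lecture Note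
  Ser. 431, Cambridge Univ. Press 2016, doi:10.1017/cbo9781316341063 — (2.1.1)–(2.1.7), Exercise
  2.4.3, (5.1.5), Theorem 5.3.5 and eq. (5.3.1) p. 59. [key `Stoll2016`]
-/

noncomputable section

open MeasureTheory MeasureTheory.Measure Metric Set Filter Function Module
open scoped ENNReal InnerProductSpace Topology

namespace Literature.Analysis.Potential

namespace SphereMoebius

variable {V : Type*} [NormedAddCommGroup V] [InnerProductSpace ℝ V]

/-! ## §1. The sphere inversion `J = φ_a|_𝕊` and its algebra -/

/-- The conformal factor `c(y) = (1 − |a|²)/|y − a|²` of `φ_a` at a boundary point. [folklore] -/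
def coef (a y : V) : ℝ := (1 - ‖a‖ ^ 2) / ‖y - a‖ ^ 2

/-- `J(y) = a − (1 − |a|²)(y − a)/|y − a|²`: Stoll's `ψ_a(y) = a + (1 − |a|²)(a − y)^*` (2.1.1),
which agrees with `φ_a = ψ_a^*` on the unit sphere. [cite: Stoll2016, eq. (2.1.1)] -/
def sphInv (a y : V) : V := a - coef a y • (y - a)

/-- The radial (degree-one homogeneous) extension `Ψ(x) = |x| J(x/|x|)` of `J|_𝕊`. [folklore] -/
def radExt (a x : V) : V := ‖x‖ • sphInv a (‖x‖⁻¹ • x)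

section Algebra

variable {a t : V}

omit [InnerProductSpace ℝ V] in
/-- For `|a| < 1 = |t|`, `t ≠ a`, so `|t − a| ≠ 0`. [folklore] -/
theorem norm_sub_ne_zero (ha : ‖a‖ < 1) (ht : ‖t‖ = 1) : ‖t - a‖ ≠ 0 := by
  intro h
  rw [norm_eq_zero, sub_eq_zero] at h
  rw [h] at ht
  linarith

/-- On the unit sphere, `⟪a, t⟫ = (1 + |a|² − |t − a|²)/2`. [folklore] -/
theorem inner_eq_of_norm_eq_one (ht : ‖t‖ = 1) (a : V) :
    ⟪a, t⟫_ℝ = (1 + ‖a‖ ^ 2 - ‖t - a‖ ^ 2) / 2 := by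
  have h := norm_sub_sq_real t a
  rw [ht, real_inner_comm a t] at h
  linarith

omit [InnerProductSpace ℝ V] in
/-- `c(t) |t − a|² = 1 − |a|²`. [folklore] -/
theorem coef_mul_norm_sq (ha : ‖a‖ < 1) (ht : ‖t‖ = 1) :
    coef a t * ‖t - a‖ ^ 2 = 1 - ‖a‖ ^ 2 := by
  have h := norm_sub_ne_zero ha ht
  rw [coef, div_mul_cancel₀ _ (pow_ne_zero 2 h)]

omit [InnerProductSpace ℝ V] in
/-- `c(t) > 0` for `|a| < 1 = |t|`. [folklore] -/
theorem coef_pos (ha : ‖a‖ < 1) (ht : ‖t‖ = 1) : 0 < coef a t := by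
  have h := norm_sub_ne_zero ha ht
  have h1 : 0 < 1 - ‖a‖ ^ 2 := by nlinarith [norm_nonneg a]
  exact div_pos h1 (by positivity)

/-- `J` maps the unit sphere to itself: `|J(t)| = 1` for `|t| = 1`, `|a| < 1` (Stoll (2.1.3) with
`|x| = 1`). [cite: Stoll2016, eq. (2.1.3)] -/
theorem norm_sphInv (ha : ‖a‖ < 1) (ht : ‖t‖ = 1) : ‖sphInv a t‖ = 1 := by
  have hta := norm_sub_ne_zero ha ht
  have hm := inner_eq_of_norm_eq_one ht a
  have key : ‖sphInv a t‖ ^ 2 = 1 := by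
    rw [sphInv, norm_sub_sq_real, norm_smul, mul_pow, Real.norm_eq_abs, sq_abs, inner_smul_right,
      inner_sub_right, real_inner_self_eq_norm_sq, hm, coef]
    field_simp
    ring
  have h0 : 0 ≤ ‖sphInv a t‖ := norm_nonneg _
  nlinarith [key, h0]

/-- `J(t) − a = −c(t) (t − a)`. [folklore] -/
theorem sphInv_sub (a t : V) : sphInv a t - a = -(coef a t • (t - a)) := by
  rw [sphInv]; abel

/-- `c(J(t)) = c(t)⁻¹` on the unit sphere (equivalently `|a − J(t)| = (1 − |a|²)/|a − t|`,
Stoll's Exercise 2.4.3). [cite: Stoll2016, Exercise 2.4.3] -/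
theorem coef_sphInv (ha : ‖a‖ < 1) (ht : ‖t‖ = 1) : coef a (sphInv a t) = (coef a t)⁻¹ := by
  have hta := norm_sub_ne_zero ha ht
  have hc := coef_pos ha ht
  have hκ : 0 < 1 - ‖a‖ ^ 2 := by nlinarith [norm_nonneg a]
  have h1 : ‖sphInv a t - a‖ ^ 2 = coef a t ^ 2 * ‖t - a‖ ^ 2 := by
    rw [sphInv_sub, norm_neg, norm_smul, mul_pow, Real.norm_eq_abs, sq_abs]
  rw [coef, h1]
  have h2 : coef a t ^ 2 * ‖t - a‖ ^ 2 = coef a t * (1 - ‖a‖ ^ 2) := by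
    rw [sq, mul_assoc, coef_mul_norm_sq ha ht]
  rw [h2]
  field_simp

/-- `J` is an involution of the unit sphere: `J(J(t)) = t`. [folklore] -/
theorem sphInv_sphInv (ha : ‖a‖ < 1) (ht : ‖t‖ = 1) : sphInv a (sphInv a t) = t := by
  have hc := coef_pos ha ht
  have h : sphInv a (sphInv a t) = a - coef a (sphInv a t) • (sphInv a t - a) := rfl
  rw [h, coef_sphInv ha ht, sphInv_sub, smul_neg, smul_smul, inv_mul_cancel₀ hc.ne', one_smul]
  abel

/-- The kernel identity `c(t)^k · c(J t)^k = 1` (i.e. `P_h(a,t) P_h(a,φ_a t) = 1`). [folklore] -/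
theorem coef_pow_mul_coef_sphInv_pow (ha : ‖a‖ < 1) (ht : ‖t‖ = 1) (k : ℕ) :
    coef a t ^ k * coef a (sphInv a t) ^ k = 1 := by
  rw [coef_sphInv ha ht, ← mul_pow, mul_inv_cancel₀ (coef_pos ha ht).ne', one_pow]

/-! ## §2. The radial extension `Ψ` -/

/-- `Ψ(0) = 0`. [folklore] -/
theorem radExt_zero (a : V) : radExt a 0 = 0 := by
  simp [radExt]

/-- `|x/|x|| = 1` for `x ≠ 0`. [folklore] -/
theorem norm_normalize {x : V} (hx : x ≠ 0) : ‖‖x‖⁻¹ • x‖ = 1 := by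
  rw [norm_smul, norm_inv, norm_norm, inv_mul_cancel₀ (norm_ne_zero_iff.2 hx)]

/-- `Ψ` preserves the norm (`|a| < 1`). [folklore] -/
theorem norm_radExt (ha : ‖a‖ < 1) (x : V) : ‖radExt a x‖ = ‖x‖ := by
  by_cases hx : x = 0
  · rw [hx, radExt_zero, norm_zero]
  · rw [radExt, norm_smul, norm_norm, norm_sphInv ha (norm_normalize hx), mul_one]

/-- `Ψ` is positively homogeneous of degree one. [folklore] -/
theorem radExt_smul (a : V) {c : ℝ} (hc : 0 < c) (x : V) : radExt a (c • x) = c • radExt a x := by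
  by_cases hx : x = 0
  · rw [hx, smul_zero, radExt_zero, smul_zero]
  · have hx0 : ‖x‖ ≠ 0 := norm_ne_zero_iff.2 hx
    have h1 : ‖c • x‖ = c * ‖x‖ := by rw [norm_smul, Real.norm_of_nonneg hc.le]
    have h2 : (c * ‖x‖)⁻¹ • (c • x) = ‖x‖⁻¹ • x := by
      rw [smul_smul, mul_inv, mul_right_comm, inv_mul_cancel₀ hc.ne', one_mul]
    rw [radExt, radExt, h1, h2, mul_smul]

/-- On the unit sphere `Ψ = J`. [folklore] -/
theorem radExt_of_norm_eq_one (a : V) (ht : ‖t‖ = 1) : radExt a t = sphInv a t := by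
  rw [radExt, ht, inv_one, one_smul, one_smul]

/-- The direction of `Ψ(x)` is `J(x/|x|)` (`x ≠ 0`). [folklore] -/
theorem normalize_radExt (ha : ‖a‖ < 1) {x : V} (hx : x ≠ 0) :
    ‖radExt a x‖⁻¹ • radExt a x = sphInv a (‖x‖⁻¹ • x) := by
  rw [norm_radExt ha, radExt, smul_smul, inv_mul_cancel₀ (norm_ne_zero_iff.2 hx), one_smul]

/-- `Ψ` is an involution (`|a| < 1`). [folklore] -/
theorem radExt_radExt (ha : ‖a‖ < 1) (x : V) : radExt a (radExt a x) = x := by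
  by_cases hx : x = 0
  · rw [hx, radExt_zero, radExt_zero]
  · have h : radExt a (radExt a x) = ‖radExt a x‖ • sphInv a (‖radExt a x‖⁻¹ • radExt a x) := rfl
    rw [h, normalize_radExt ha hx, norm_radExt ha, sphInv_sphInv ha (norm_normalize hx), smul_smul,
      mul_inv_cancel₀ (norm_ne_zero_iff.2 hx), one_smul]

/-- `Ψ` is injective (on any set). [folklore] -/
theorem injOn_radExt (ha : ‖a‖ < 1) (s : Set V) : InjOn (radExt a) s := by
  intro x _ y _ h
  rw [← radExt_radExt ha x, ← radExt_radExt ha y, h]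

/-- `Ψ` maps `V ∖ {0}` onto itself. [folklore] -/
theorem image_radExt_compl_zero (ha : ‖a‖ < 1) : radExt a '' ({0}ᶜ : Set V) = {0}ᶜ := by
  ext y
  simp only [mem_image, mem_compl_iff, mem_singleton_iff]
  constructor
  · rintro ⟨x, hx, rfl⟩ h
    apply hx
    rw [← norm_eq_zero, ← norm_radExt ha x, h, norm_zero]
  · intro hy
    refine ⟨radExt a y, fun h => hy ?_, radExt_radExt ha y⟩
    rw [← norm_eq_zero, ← norm_radExt ha y, h, norm_zero]

end Algebra

/-! ## §3. Derivatives -/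

/-- The derivative of `J` at `y ≠ a`:
`h ↦ (2κ/|y − a|⁴) ⟪y − a, h⟫ (y − a) − c(y) h`, `κ = 1 − |a|²`. [folklore] -/
def sphInvDeriv (a y : V) : V →L[ℝ] V :=
  (2 * (1 - ‖a‖ ^ 2) / (‖y - a‖ ^ 2) ^ 2) • (innerSL ℝ (y - a)).smulRight (y - a) -
    coef a y • ContinuousLinearMap.id ℝ V

/-- `sphInvDeriv` applied to a vector. [folklore] -/
theorem sphInvDeriv_apply (a y h : V) :
    sphInvDeriv a y h =
      (2 * (1 - ‖a‖ ^ 2) / (‖y - a‖ ^ 2) ^ 2 * ⟪y - a, h⟫_ℝ) • (y - a) - coef a y • h := by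
  simp only [sphInvDeriv, _root_.sub_apply, _root_.smul_apply, ContinuousLinearMap.smulRight_apply,
    innerSL_apply_apply, ContinuousLinearMap.id_apply, smul_smul]

/-- **`J` is differentiable off `a`** with derivative `sphInvDeriv a y`. [folklore] -/
theorem hasFDerivAt_sphInv {a y : V} (hy : y ≠ a) : HasFDerivAt (sphInv a) (sphInvDeriv a y) y := by
  have hg0 : ‖y - a‖ ^ 2 ≠ 0 := pow_ne_zero 2 (norm_ne_zero_iff.2 (sub_ne_zero.2 hy))
  have h0 : HasFDerivAt (fun z : V => z - a) (ContinuousLinearMap.id ℝ V) y :=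
    (hasFDerivAt_id y).sub_const a
  have h1 : HasFDerivAt (fun z : V => ‖z - a‖ ^ 2)
      ((2 : ℕ) • (innerSL ℝ (y - a)).comp (ContinuousLinearMap.id ℝ V)) y := h0.norm_sq
  have h2 : HasFDerivAt (fun z : V => (‖z - a‖ ^ 2)⁻¹)
      ((-((‖y - a‖ ^ 2) ^ 2)⁻¹) • ((2 : ℕ) • (innerSL ℝ (y - a)).comp (ContinuousLinearMap.id ℝ V))) y :=
    (hasDerivAt_inv hg0).comp_hasFDerivAt y h1
  have h3 : HasFDerivAt (fun z : V => coef a z)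
      ((1 - ‖a‖ ^ 2) • ((-((‖y - a‖ ^ 2) ^ 2)⁻¹) •
        ((2 : ℕ) • (innerSL ℝ (y - a)).comp (ContinuousLinearMap.id ℝ V)))) y := by
    have h := h2.const_mul (1 - ‖a‖ ^ 2)
    simpa only [coef, div_eq_mul_inv] using h
  have h4 : HasFDerivAt (fun z : V => coef a z • (z - a))
      (coef a y • ContinuousLinearMap.id ℝ V +
        ((1 - ‖a‖ ^ 2) • ((-((‖y - a‖ ^ 2) ^ 2)⁻¹) •
          ((2 : ℕ) • (innerSL ℝ (y - a)).comp (ContinuousLinearMap.id ℝ V)))).smulRight (y - a)) y :=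
    h3.smul h0
  have h5 : HasFDerivAt (sphInv a)
      (-(coef a y • ContinuousLinearMap.id ℝ V +
        ((1 - ‖a‖ ^ 2) • ((-((‖y - a‖ ^ 2) ^ 2)⁻¹) •
          ((2 : ℕ) • (innerSL ℝ (y - a)).comp (ContinuousLinearMap.id ℝ V)))).smulRight (y - a))) y :=
    h4.const_sub a
  refine h5.congr_fderiv ?_
  ext h
  rw [sphInvDeriv_apply]
  simp only [_root_.neg_apply, _root_.add_apply, _root_.smul_apply, ContinuousLinearMap.id_apply,
    ContinuousLinearMap.smulRight_apply, ContinuousLinearMap.comp_apply, innerSL_apply_apply,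
    smul_eq_mul, two_smul]
  have e : (1 - ‖a‖ ^ 2) * (-((‖y - a‖ ^ 2) ^ 2)⁻¹ * (⟪y - a, h⟫_ℝ + ⟪y - a, h⟫_ℝ)) =
      -(2 * (1 - ‖a‖ ^ 2) / (‖y - a‖ ^ 2) ^ 2 * ⟪y - a, h⟫_ℝ) := by
    field_simp
    ring
  rw [e]
  module

/-- The norm-one normalisation `y ↦ y/|y|` has derivative `h ↦ h − ⟪t, h⟫ t` (the tangential
projection) at a unit vector `t`. [folklore] -/
theorem hasFDerivAt_normalize {t : V} (ht : ‖t‖ = 1) :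
    HasFDerivAt (fun y : V => ‖y‖⁻¹ • y)
      (ContinuousLinearMap.id ℝ V - (innerSL ℝ t).smulRight t) t := by
  have ht0 : t ≠ 0 := by
    rintro rfl
    simp at ht
  have hn : HasFDerivAt (fun y : V => ‖y‖) (‖t‖⁻¹ • innerSL ℝ t) t :=
    Literature.Analysis.FluidPDE.hasFDerivAt_norm_of_ne_zero_inner ht0
  have h1 : ‖t‖ ≠ 0 := by rw [ht]; exact one_ne_zero
  have hinv : HasFDerivAt (fun y : V => ‖y‖⁻¹) ((-(‖t‖ ^ 2)⁻¹) • (‖t‖⁻¹ • innerSL ℝ t)) t :=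
    (hasDerivAt_inv h1).comp_hasFDerivAt t hn
  have h := hinv.smul (hasFDerivAt_id t)
  refine h.congr_fderiv ?_
  ext v
  simp only [_root_.add_apply, _root_.neg_apply, ContinuousLinearMap.id_apply,
    ContinuousLinearMap.smulRight_apply, innerSL_apply_apply, ht, inv_one, one_pow, one_smul, id_eq,
    neg_smul, sub_eq_add_neg]

/-- The reflection `R = 1 − (2/|t − a|²) (t − a) ⊗ (t − a)` in the hyperplane orthogonal to
`t − a`. [folklore] -/
def reflSub (a t : V) : V →L[ℝ] V :=
  ContinuousLinearMap.id ℝ V - (2 / ‖t - a‖ ^ 2) • (innerSL ℝ (t - a)).smulRight (t - a)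

/-- `D' = −c(t)·1 + (1 + c(t)) t ⊗ t`: multiplication by `−c(t)` on `t^⊥`, identity on `ℝ t`
(for `|t| = 1`). [folklore] -/
def dPrime (a t : V) : V →L[ℝ] V :=
  (-coef a t) • ContinuousLinearMap.id ℝ V + (1 + coef a t) • (innerSL ℝ t).smulRight t

/-- The derivative of `Ψ` at a unit vector `t`, in factored form `R ∘ D'`. [folklore] -/
def radExtDeriv (a t : V) : V →L[ℝ] V := (reflSub a t).comp (dPrime a t)

/-- `reflSub` applied to a vector. [folklore] -/
theorem reflSub_apply (a t v : V) :
    reflSub a t v = v - (2 / ‖t - a‖ ^ 2 * ⟪t - a, v⟫_ℝ) • (t - a) := by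
  simp only [reflSub, _root_.sub_apply, _root_.smul_apply, ContinuousLinearMap.smulRight_apply,
    innerSL_apply_apply, ContinuousLinearMap.id_apply, smul_smul]

/-- `dPrime` applied to a vector. [folklore] -/
theorem dPrime_apply (a t v : V) :
    dPrime a t v = (-coef a t) • v + ((1 + coef a t) * ⟪t, v⟫_ℝ) • t := by
  simp only [dPrime, _root_.add_apply, _root_.smul_apply, ContinuousLinearMap.smulRight_apply,
    innerSL_apply_apply, ContinuousLinearMap.id_apply, smul_smul]

/-- **`Ψ` is differentiable at every unit vector `t`**, with derivative `radExtDeriv a t = R ∘ D'`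
(`|a| < 1`): the derivative of `|y| J(y/|y|)` is `h ↦ ⟪t,h⟫ J(t) + DJ(t)(h − ⟪t,h⟫ t)`, and this
equals `R(D' h)` because `DJ(t) = −c(t) R` and `R t = J(t)`. [folklore] -/
theorem hasFDerivAt_radExt_of_norm_eq_one {a t : V} (ha : ‖a‖ < 1) (ht : ‖t‖ = 1) :
    HasFDerivAt (radExt a) (radExtDeriv a t) t := by
  have ht0 : t ≠ 0 := by
    rintro rfl
    simp at ht
  have hta' := norm_sub_ne_zero ha ht
  have hta : t ≠ a := fun h => hta' (by rw [h, sub_self, norm_zero])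
  have hg : ‖t - a‖ ^ 2 ≠ 0 := pow_ne_zero 2 hta'
  have hNt : ‖t‖⁻¹ • t = t := by rw [ht, inv_one, one_smul]
  have hN := hasFDerivAt_normalize ht
  have hJ : HasFDerivAt (sphInv a) (sphInvDeriv a t) (‖t‖⁻¹ • t) := by
    rw [hNt]; exact hasFDerivAt_sphInv hta
  have hJN : HasFDerivAt (fun y : V => sphInv a (‖y‖⁻¹ • y))
      ((sphInvDeriv a t).comp (ContinuousLinearMap.id ℝ V - (innerSL ℝ t).smulRight t)) t :=
    HasFDerivAt.comp (f := fun y : V => ‖y‖⁻¹ • y) t hJ hN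
  have hn : HasFDerivAt (fun y : V => ‖y‖) (‖t‖⁻¹ • innerSL ℝ t) t :=
    Literature.Analysis.FluidPDE.hasFDerivAt_norm_of_ne_zero_inner ht0
  have h : HasFDerivAt (radExt a)
      (‖t‖ • (sphInvDeriv a t).comp (ContinuousLinearMap.id ℝ V - (innerSL ℝ t).smulRight t) +
        (‖t‖⁻¹ • innerSL ℝ t).smulRight (sphInv a (‖t‖⁻¹ • t))) t :=
    hn.smul hJN
  refine h.congr_fderiv ?_
  rw [hNt, ht, inv_one, one_smul, one_smul]
  have hm := inner_eq_of_norm_eq_one ht a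
  ext v
  simp only [radExtDeriv, ContinuousLinearMap.comp_apply, reflSub_apply, dPrime_apply,
    _root_.add_apply, sphInvDeriv_apply, ContinuousLinearMap.smulRight_apply, _root_.sub_apply,
    ContinuousLinearMap.id_apply, innerSL_apply_apply, sphInv, coef]
  simp only [inner_sub_left, inner_sub_right, inner_add_right, inner_smul_right,
    real_inner_self_eq_norm_sq, ht, one_pow, hm]
  match_scalars <;> field_simp <;> ring

/-- By homogeneity, **`Ψ` is differentiable at every `x ≠ 0`** with derivative
`radExtDeriv a (x/|x|)`. [folklore] -/
theorem hasFDerivAt_radExt {a x : V} (ha : ‖a‖ < 1) (hx : x ≠ 0) :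
    HasFDerivAt (radExt a) (radExtDeriv a (‖x‖⁻¹ • x)) x := by
  have hr0 : 0 < ‖x‖ := norm_pos_iff.2 hx
  have ht : ‖‖x‖⁻¹ • x‖ = 1 := norm_normalize hx
  have hunit := hasFDerivAt_radExt_of_norm_eq_one ha ht
  have hsc : HasFDerivAt (fun y : V => ‖x‖⁻¹ • y) (‖x‖⁻¹ • ContinuousLinearMap.id ℝ V) x :=
    (hasFDerivAt_id x).const_smul ‖x‖⁻¹
  have hcomp : HasFDerivAt (fun y : V => ‖x‖ • radExt a (‖x‖⁻¹ • y))
      (‖x‖ • (radExtDeriv a (‖x‖⁻¹ • x)).comp (‖x‖⁻¹ • ContinuousLinearMap.id ℝ V)) x :=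
    (hunit.comp x hsc).const_smul ‖x‖
  have hfun : (fun y : V => ‖x‖ • radExt a (‖x‖⁻¹ • y)) = radExt a := by
    funext y
    rw [radExt_smul a (inv_pos.2 hr0), smul_smul, mul_inv_cancel₀ hr0.ne', one_smul]
  rw [hfun] at hcomp
  refine hcomp.congr_fderiv ?_
  ext v
  simp only [_root_.smul_apply, ContinuousLinearMap.comp_apply,
    ContinuousLinearMap.id_apply, map_smul, smul_smul, mul_inv_cancel₀ hr0.ne', one_smul]

/-! ## §4. The Jacobian determinant `|det DΨ(t)| = P_h(a,t)` -/

/-- **The Jacobian of `φ_a|_𝕊`**: `|det DΨ(t)| = c(t)^{n−1} = ((1 − |a|²)/|t − a|²)^{n−1}`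
(`n = dim V`), the invariant Poisson kernel `P_h(a,t)` — `det R = −1` and `det D' = (−c)^{n−1}` by
the rank-one determinant lemma. [folklore] -/
theorem abs_det_radExtDeriv [FiniteDimensional ℝ V] [Nontrivial V] {a t : V} (ha : ‖a‖ < 1)
    (ht : ‖t‖ = 1) : |(radExtDeriv a t).det| = coef a t ^ (finrank ℝ V - 1) := by
  have hta := norm_sub_ne_zero ha ht
  have hg : ‖t - a‖ ^ 2 ≠ 0 := pow_ne_zero 2 hta
  have hc := coef_pos ha ht
  have hcoeR : ((reflSub a t : V →L[ℝ] V) : V →ₗ[ℝ] V) =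
      1 + ((-(2 / ‖t - a‖ ^ 2)) • ((innerSL ℝ (t - a) : V →L[ℝ] ℝ) : V →ₗ[ℝ] ℝ)).smulRight (t - a) := by
    ext v
    rw [ContinuousLinearMap.coe_coe, reflSub_apply]
    simp only [LinearMap.add_apply, Module.End.one_apply, LinearMap.smulRight_apply,
      LinearMap.neg_apply, LinearMap.smul_apply, ContinuousLinearMap.coe_coe, innerSL_apply_apply,
      smul_eq_mul, neg_smul, sub_eq_add_neg]
  have hcoeD : ((dPrime a t : V →L[ℝ] V) : V →ₗ[ℝ] V) =
      (-coef a t) • (1 : V →ₗ[ℝ] V) +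
        (((1 + coef a t)) • ((innerSL ℝ t : V →L[ℝ] ℝ) : V →ₗ[ℝ] ℝ)).smulRight t := by
    ext v
    rw [ContinuousLinearMap.coe_coe, dPrime_apply]
    simp [mul_smul]
  have hdetR : LinearMap.det ((reflSub a t : V →L[ℝ] V) : V →ₗ[ℝ] V) = -1 := by
    rw [hcoeR, Literature.Analysis.FluidPDE.LinearMap.det_one_add_smulRight]
    simp only [LinearMap.smul_apply, ContinuousLinearMap.coe_coe, innerSL_apply_apply,
      real_inner_self_eq_norm_sq, smul_eq_mul]
    field_simp
    ring
  have hdetD : LinearMap.det ((dPrime a t : V →L[ℝ] V) : V →ₗ[ℝ] V) =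
      (-coef a t) ^ (finrank ℝ V - 1) := by
    rw [hcoeD, Literature.Analysis.FluidPDE.LinearMap.det_smul_one_add_smulRight (neg_ne_zero.2 hc.ne')]
    simp only [LinearMap.smul_apply, ContinuousLinearMap.coe_coe, innerSL_apply_apply,
      real_inner_self_eq_norm_sq, ht, one_pow, smul_eq_mul, mul_one]
    ring
  rw [radExtDeriv, ContinuousLinearMap.det, ContinuousLinearMap.toLinearMap_comp, LinearMap.det_comp,
    hdetR, hdetD, neg_one_mul, abs_neg, abs_pow, abs_neg, abs_of_pos hc]

/-! ## §5. Polar coordinates for functions of the direction -/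

section Polar

variable {E : Type*} [NormedAddCommGroup E] [NormedSpace ℝ E] [FiniteDimensional ℝ E]
  [MeasurableSpace E] [BorelSpace E] [Nontrivial E] (μ : Measure E) [μ.IsAddHaarMeasure]

/-- **Polar coordinates for a function of the direction only**: for every `G : E → ℝ`,
`∫_{|x|<1} G(x/|x|) dμ = (dim E)⁻¹ ∫_𝕊 G dμ.toSphere` (no measurability or integrability is
needed: both sides are Bochner integrals). From `measurePreserving_homeomorphUnitSphereProd`
(`μ|_{E∖0} ≅ μ.toSphere ⊗ r^{dim E−1} dr`) and `∫_0^1 r^{dim E−1} dr = (dim E)⁻¹`. [folklore] -/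
theorem integral_ball_comp_normalize (G : E → ℝ) :
    ∫ x in ball (0 : E) 1, G (‖x‖⁻¹ • x) ∂μ =
      (finrank ℝ E : ℝ)⁻¹ * ∫ t : sphere (0 : E) 1, G t ∂μ.toSphere := by
  set F : E → ℝ := (ball (0 : E) 1).indicator fun x => G (‖x‖⁻¹ • x) with hF
  set r₁ : Ioi (0 : ℝ) := ⟨1, mem_Ioi.2 one_pos⟩ with hr₁
  have h1 : ∫ x in ball (0 : E) 1, G (‖x‖⁻¹ • x) ∂μ = ∫ x, F x ∂μ :=
    (integral_indicator measurableSet_ball).symm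
  have h2 : ∫ x, F x ∂μ = ∫ x : ({(0 : E)}ᶜ : Set E), F x ∂(μ.comap (↑)) := by
    rw [integral_subtype_comap (measurableSet_singleton _).compl, restrict_compl_singleton]
  have h3 : ∫ x : ({(0 : E)}ᶜ : Set E), F x ∂(μ.comap (↑)) =
      ∫ p : sphere (0 : E) 1 × Ioi (0 : ℝ), G p.1 * (Iio r₁).indicator 1 p.2
        ∂(μ.toSphere.prod (volumeIoiPow (finrank ℝ E - 1))) := by
    rw [← (μ.measurePreserving_homeomorphUnitSphereProd).integral_comp
      (Homeomorph.measurableEmbedding _)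
      (fun p : sphere (0 : E) 1 × Ioi (0 : ℝ) => G p.1 * (Iio r₁).indicator 1 p.2)]
    congr 1
    funext x
    have hx0 : ‖(x : E)‖ ≠ 0 := norm_ne_zero_iff.2 x.2
    have hfst : ((homeomorphUnitSphereProd E x).1 : E) = ‖(x : E)‖⁻¹ • (x : E) :=
      homeomorphUnitSphereProd_apply_fst_coe E x
    have hsnd : ((homeomorphUnitSphereProd E x).2 : ℝ) = ‖(x : E)‖ :=
      homeomorphUnitSphereProd_apply_snd_coe E x
    by_cases hb : ‖(x : E)‖ < 1
    · have hmem : (x : E) ∈ ball (0 : E) 1 := mem_ball_zero_iff.2 hb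
      have hmem' : (homeomorphUnitSphereProd E x).2 ∈ Iio r₁ := by
        rw [mem_Iio, ← Subtype.coe_lt_coe, hsnd]
        exact hb
      rw [hF, indicator_of_mem hmem, indicator_of_mem hmem', hfst, Pi.one_apply, mul_one]
    · have hmem : (x : E) ∉ ball (0 : E) 1 := fun h => hb (mem_ball_zero_iff.1 h)
      have hmem' : (homeomorphUnitSphereProd E x).2 ∉ Iio r₁ := by
        rw [mem_Iio, ← Subtype.coe_lt_coe, hsnd]
        exact hb
      rw [hF, indicator_of_notMem hmem, indicator_of_notMem hmem', mul_zero]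
  have h4 : ∫ p : sphere (0 : E) 1 × Ioi (0 : ℝ), G p.1 * (Iio r₁).indicator 1 p.2
        ∂(μ.toSphere.prod (volumeIoiPow (finrank ℝ E - 1))) =
      (∫ t : sphere (0 : E) 1, G t ∂μ.toSphere) *
        ∫ r : Ioi (0 : ℝ), (Iio r₁).indicator 1 r ∂(volumeIoiPow (finrank ℝ E - 1)) :=
    integral_prod_mul (fun t : sphere (0 : E) 1 => G t)
      (fun r : Ioi (0 : ℝ) => (Iio r₁).indicator (1 : Ioi (0 : ℝ) → ℝ) r)
  have h5 : ∫ r : Ioi (0 : ℝ), (Iio r₁).indicator 1 r ∂(volumeIoiPow (finrank ℝ E - 1)) =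
      (finrank ℝ E : ℝ)⁻¹ := by
    have hd : 0 < finrank ℝ E := finrank_pos
    have hr1 : (r₁ : ℝ) = 1 := rfl
    rw [integral_indicator_one measurableSet_Iio, measureReal_def, volumeIoiPow_apply_Iio, hr1,
      one_pow, Nat.cast_pred hd, sub_add_cancel, ENNReal.toReal_ofReal (by positivity), one_div]
  rw [h1, h2, h3, h4, h5, mul_comm]

end Polar

/-! ## §6. The change of variables under `Ψ` -/

section ChangeOfVariables

variable [FiniteDimensional ℝ V] [MeasurableSpace V] [BorelSpace V] [Nontrivial V]
  (μ : Measure V) [μ.IsAddHaarMeasure]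

/-- **Change of variables under the involution `Ψ`** on the unit ball: for every `H : V → ℝ`,
`∫_𝔹 H dμ = ∫_𝔹 c(x/|x|)^{n−1} H(Ψ x) dμ(x)` (Mathlib's
`integral_image_eq_integral_abs_det_fderiv_smul` on `V ∖ {0}`, `Ψ(V ∖ {0}) = V ∖ {0}`, `Ψ`
injective and norm-preserving, `|det DΨ(x)| = c(x/|x|)^{n−1}`). [folklore] -/
theorem integral_ball_radExt {a : V} (ha : ‖a‖ < 1) (H : V → ℝ) :
    ∫ x in ball (0 : V) 1, H x ∂μ =
      ∫ x in ball (0 : V) 1, coef a (‖x‖⁻¹ • x) ^ (finrank ℝ V - 1) * H (radExt a x) ∂μ := by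
  have hcov := integral_image_eq_integral_abs_det_fderiv_smul μ
    (measurableSet_singleton (0 : V)).compl (f := radExt a)
    (f' := fun x => radExtDeriv a (‖x‖⁻¹ • x))
    (fun x hx => (hasFDerivAt_radExt ha (mem_compl_singleton_iff.1 hx)).hasFDerivWithinAt)
    (injOn_radExt ha _) ((ball (0 : V) 1).indicator H)
  rw [image_radExt_compl_zero ha, restrict_compl_singleton, integral_indicator measurableSet_ball]
    at hcov
  rw [hcov, ← integral_indicator measurableSet_ball]
  refine integral_congr_ae ?_
  have h0 : ∀ᵐ x ∂μ, x ∉ ({0} : Set V) := measure_eq_zero_iff_ae_notMem.1 (measure_singleton 0)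
  filter_upwards [h0] with x hx
  rw [mem_singleton_iff] at hx
  have ht : ‖‖x‖⁻¹ • x‖ = 1 := norm_normalize hx
  have hball : radExt a x ∈ ball (0 : V) 1 ↔ x ∈ ball (0 : V) 1 := by
    rw [mem_ball_zero_iff, mem_ball_zero_iff, norm_radExt ha]
  by_cases hxb : x ∈ ball (0 : V) 1
  · rw [indicator_of_mem (hball.2 hxb), indicator_of_mem hxb, abs_det_radExtDeriv ha ht, smul_eq_mul]
  · rw [indicator_of_notMem (fun h => hxb (hball.1 h)), indicator_of_notMem hxb, smul_zero]

end ChangeOfVariables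

end SphereMoebius

/-! ## §7. The discharge of `Stoll2016_eq531` -/

open SphereMoebius HyperbolicBall

/-- On the unit sphere Stoll's `φ_a` **is** the inversion `J`: for `|a| < 1 = |t|`,
`φ_a(t) = a − (1 − |a|²)(t − a)/|t − a|²` (since `ρ(t,a) = |t − a|²` there; (2.1.6) versus
(2.1.1)/(2.1.4)). [cite: Stoll2016, eq. (2.1.6)] -/
theorem SphereMoebius.moebius_eq_sphInv {n : ℕ} {a t : EuclideanSpace ℝ (Fin n)} (ha : ‖a‖ < 1)
    (ht : ‖t‖ = 1) : moebius a t = sphInv a t := by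
  have hg : ‖t - a‖ ^ 2 ≠ 0 := pow_ne_zero 2 (norm_sub_ne_zero ha ht)
  rw [moebius, rho, ht, one_pow, sub_self, mul_zero, add_zero, smul_add, smul_smul,
    inv_mul_cancel₀ hg, one_smul, smul_smul, sphInv, coef, div_eq_inv_mul]
  module

/-- The invariant Poisson kernel is the `(n−1)`-st power of the conformal factor:
`P_h(a,t) = c(t)^{n−1}`. [cite: Stoll2016, eq. (5.1.5)] -/
theorem SphereMoebius.poissonKernel_eq_coef_pow {n : ℕ} (a t : EuclideanSpace ℝ (Fin n)) :
    poissonKernel n a t = coef a t ^ (n - 1) := rfl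

/-- **Stoll 2016, eq. (5.3.1)** (discharge of the named fact `Stoll2016_eq531`): for `n ≥ 2`,
`a ∈ 𝔹` and every `f` (integrable on the sphere or not — both sides are Bochner integrals),
`∫_𝕊 f(φ_a(t)) dσ(t) = ∫_𝕊 P_h(a,t) f(t) dσ(t)`, `σ = volume.toSphere` the surface measure of the
unit sphere of `ℝⁿ`. Printed as a corollary of Theorem 5.3.5; proved here as the change of
variables for `φ_a|_𝕊` (Jacobian `P_h(a,·)`), see the module docstring.
[cite: Stoll2016, Theorem 5.3.5, eq. (5.3.1) p. 59] -/
theorem Stoll2016_eq531_holds : Stoll2016_eq531 := by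
  intro n hn a ha f _hf
  have hE : finrank ℝ (EuclideanSpace ℝ (Fin n)) = n := finrank_euclideanSpace_fin
  haveI : Nontrivial (EuclideanSpace ℝ (Fin n)) :=
    Module.nontrivial_of_finrank_pos (R := ℝ) (by rw [hE]; omega)
  rw [mem_ball_zero_iff] at ha
  have hn0 : (n : ℝ) ≠ 0 := by exact_mod_cast (show n ≠ 0 by omega)
  have h0 : ∀ᵐ x ∂(volume : Measure (EuclideanSpace ℝ (Fin n))), x ∉ ({0} : Set _) :=
    measure_eq_zero_iff_ae_notMem.1 (measure_singleton 0)
  -- (i) on the sphere `φ_a = J`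
  have h1 : ∫ t : sphere (0 : EuclideanSpace ℝ (Fin n)) 1, f (moebius a t)
        ∂(volume : Measure (EuclideanSpace ℝ (Fin n))).toSphere =
      ∫ t : sphere (0 : EuclideanSpace ℝ (Fin n)) 1, f (sphInv a t)
        ∂(volume : Measure (EuclideanSpace ℝ (Fin n))).toSphere := by
    refine integral_congr_ae (ae_of_all _ fun t => ?_)
    have ht : ‖(t : EuclideanSpace ℝ (Fin n))‖ = 1 := norm_eq_of_mem_sphere t
    simp only [moebius_eq_sphInv ha ht]
  -- (ii) polar coordinates for both sides
  have h2 := integral_ball_comp_normalize (volume : Measure (EuclideanSpace ℝ (Fin n)))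
    (fun y => f (sphInv a y))
  have h3 := integral_ball_comp_normalize (volume : Measure (EuclideanSpace ℝ (Fin n)))
    (fun y => poissonKernel n a y * f y)
  -- (iii) the change of variables under `Ψ` and the kernel identity
  have h4 : ∫ x in ball (0 : EuclideanSpace ℝ (Fin n)) 1,
        poissonKernel n a (‖x‖⁻¹ • x) * f (‖x‖⁻¹ • x) ∂volume =
      ∫ x in ball (0 : EuclideanSpace ℝ (Fin n)) 1, f (sphInv a (‖x‖⁻¹ • x)) ∂volume := by
    rw [integral_ball_radExt volume ha (fun y => poissonKernel n a (‖y‖⁻¹ • y) * f (‖y‖⁻¹ • y))]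
    refine integral_congr_ae ?_
    filter_upwards [ae_restrict_of_ae (s := ball (0 : EuclideanSpace ℝ (Fin n)) 1) h0] with x hx
    rw [mem_singleton_iff] at hx
    rw [normalize_radExt ha hx, hE, poissonKernel_eq_coef_pow, ← mul_assoc,
      coef_pow_mul_coef_sphInv_pow ha (norm_normalize hx), one_mul]
  calc ∫ t : sphere (0 : EuclideanSpace ℝ (Fin n)) 1, f (moebius a t)
        ∂(volume : Measure (EuclideanSpace ℝ (Fin n))).toSphere
      = ∫ t : sphere (0 : EuclideanSpace ℝ (Fin n)) 1, f (sphInv a t)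
          ∂(volume : Measure (EuclideanSpace ℝ (Fin n))).toSphere := h1
    _ = n * ∫ x in ball (0 : EuclideanSpace ℝ (Fin n)) 1, f (sphInv a (‖x‖⁻¹ • x)) ∂volume := by
          rw [h2, hE, ← mul_assoc, mul_inv_cancel₀ hn0, one_mul]
    _ = n * ∫ x in ball (0 : EuclideanSpace ℝ (Fin n)) 1,
          poissonKernel n a (‖x‖⁻¹ • x) * f (‖x‖⁻¹ • x) ∂volume := by rw [h4]
    _ = ∫ t : sphere (0 : EuclideanSpace ℝ (Fin n)) 1, poissonKernel n a t * f t
          ∂(volume : Measure (EuclideanSpace ℝ (Fin n))).toSphere := by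
          rw [h3, hE, ← mul_assoc, mul_inv_cancel₀ hn0, one_mul]

end Literature.Analysis.Potential
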